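import Literature.AnabelianGeometry.SemiGraphs.ProSigmaCuspInertiaMalnormalHolds
import Literature.AnabelianGeometry.SemiGraphs.PSCFundamentalGroup
import Mathlib.GroupTheory.DoubleCoset
import Mathlib.GroupTheory.Index
import HarnessLib

/-!
# [AbsTopI] Lemma 4.5 (v) at EVERY open subgroup: cusps of the covering `X_H → X` ↔ `H`-conjugacy
# classes of cuspidal subgroups of `H`, functorially in `H` and `Π`-equivariantly

Mochizuki, *Topics in Absolute Anabelian Geometry I* [AbsTopI], Lemma 4.5 (v) p. 55: "The set of cusps
of the covering of `X` determined by an open subgroup `H ⊆ Π` is in natural bijective correspondence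
with the set of conjugacy classes in `H` of decomposition groups of cusps [as described in (iv)];
this correspondence is functorial in `H` and compatible with the natural actions by `Π` on both
sides."  Mochizuki, *Semi-graphs of anabelioids* [SemiAnbd] Example 2.10 p. 31 / [CombGC] Def. 1.1
(ii) p. 6: for an open subgroup `H ⊆ Π_G` the cusps of the covering `G_H → G` over the cusp `c` are
the double cosets `H \ Π / Π_c` (abc-iut-L3's `PSCDatum.cuspCount`, `PSCDatum.IsCuspidalIn`), the
cuspidal subgroup of `H` at the cusp `H x Π_c` being `H ∩ x Π_c x⁻¹`.

PROOF-ONLY file (abc-iut cell, row «LEM45v-S2-GENUINE» of abc-iut-L4-lead m60/m66/m68, seat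
abc-iut-f-060 gen 6; sub-DAG AbsTopI-Lem45 node C3/C4 boundary).  abc-iut-f-060 gen 5's
`CuspInertiaData.cuspsBijInertiaClasses_ofPSC_of_smoothCurve` (p450179) is the first sentence at
`H = Π`; this file proves the first AND second sentences at EVERY open `H`, for the GEOMETRIC
(pro-`Σ` surface group) carrier, in three layers:

* §1 (abstract, any group): for a family `I_c` of INFINITE, MALNORMAL subgroups (`I_c ∩ x I_{c'} x⁻¹ = 1`
  unless `c = c'` and `x ∈ I_c`) and `H` of finite index, `H ∩ x I_c x⁻¹` is `H`-conjugate (by `h`)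
  to `H ∩ y I_{c'} y⁻¹` iff `c = c'` and `y ∈ H x I_c` (`conj_inf_conj_eq_iff_of_malnormal`): the map
  «cusp `(c, H x I_c)` ↦ `H`-class of `H ∩ x I_c x⁻¹`» is well defined and INJECTIVE on the double
  cosets, and by definition onto the cuspidal subgroups of `H` — sentence 1 at `H`; it is functorial
  in `H′ ≤ H` (`H′ ∩ x I_c x⁻¹ = H′ ∩ (H ∩ x I_c x⁻¹)`, of finite index, over the map
  `H′ x I_c ↦ H x I_c` of cusps) and `Π`-equivariant (`γ (H ∩ x I_c x⁻¹) γ⁻¹ = γHγ⁻¹ ∩ (γx) I_c (γx)⁻¹`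
  over `H x I_c ↦ (γHγ⁻¹)(γx) I_c`) — sentence 2; and the cusps over each `c` are finite in number.
* §2 (genuine carrier): the closed cusp inertia groups `Ī_c = closure ι⟨c_c⟩` of a pro-`Σ` completion
  `ι : Γ_{g,r} → Π` ARE such a family (`proSigmaCuspInertiaMalnormal_holds`, abc-iut-w5-d016 /
  L3-t11 / f-164 lineages, BY NAME) and open subgroups of the profinite `Π` have finite index.
* §3 (PSC vocabulary): the same read for a smooth-curve PSC datum `G` on `Π` with
  `G.cuspGp c = Ī_{e c}`, in terms of `PSCDatum.IsCuspidalIn` and the summands of `PSCDatum.cuspCount`.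

NOT in scope: the third sentence ("by allowing `H` to vary, a group-theoretic characterization of
the decomposition groups of cusps in `Π`" = `CuspidalAlgorithm.RecoversCusps`, FACT row F-0206),
whose arithmetic input (iii) is load-bearing (split-carrier negatives p457932 / p464465 / p464935).
Classical profinite group theory; nothing here bears on [IUTchIII] Cor 3.12; no abc claim.
-/

noncomputable section

open scoped Pointwise

namespace Literature.AnabelianGeometry.SemiGraphs.SemiGraphOfAnabelioids.IsProSigmaCompletion

open Literature.GroupTheory.CombinatorialGroupTheory

universe u

/-! ## §1. Cusps of a finite covering from an infinite malnormal family (abstract group theory) -/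

section Abstract

variable {G : Type u} [Group G] {κ : Type*}

/-- Conjugating a subgroup by one of its own elements does nothing. [folklore] -/
private theorem toConjAct_smul_eq_self_of_mem {S : Subgroup G} {k : G} (hk : k ∈ S) :
    ConjAct.toConjAct k • S = S := by
  ext x
  rw [Subgroup.mem_smul_pointwise_iff_exists]
  constructor
  · rintro ⟨s, hs, rfl⟩
    rw [ConjAct.toConjAct_smul]
    exact S.mul_mem (S.mul_mem hk hs) (S.inv_mem hk)
  · intro hx
    refine ⟨k⁻¹ * x * k, S.mul_mem (S.mul_mem (S.inv_mem hk) hx) hk, ?_⟩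
    rw [ConjAct.toConjAct_smul]
    group

/-- `(ab) S (ab)⁻¹ = a (b S b⁻¹) a⁻¹`. [folklore] -/
private theorem toConjAct_mul_smul (a b : G) (S : Subgroup G) :
    ConjAct.toConjAct (a * b) • S = ConjAct.toConjAct a • (ConjAct.toConjAct b • S) := by
  rw [map_mul, mul_smul]

/-- **A subgroup of finite index meets every infinite subgroup non-trivially** (`A ↪ G/H` would be
injective otherwise).  [folklore] [cite: MochizukiCombGC2007, Def 1.1(ii) p.6] -/
theorem inf_ne_bot_of_finiteIndex_of_infinite (H A : Subgroup G) [H.FiniteIndex] [Infinite A] :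
    H ⊓ A ≠ ⊥ := by
  intro h
  have hinj : Function.Injective (fun a : A => ((a : G) : G ⧸ H)) := by
    intro a b hab
    have hmem : (a : G)⁻¹ * b ∈ H := QuotientGroup.eq.mp hab
    have hA : (a : G)⁻¹ * b ∈ A := A.mul_mem (A.inv_mem a.2) b.2
    have h1 : (a : G)⁻¹ * b = 1 := by
      rw [← Subgroup.mem_bot, ← h]
      exact ⟨hmem, hA⟩
    exact Subtype.ext (inv_mul_eq_one.mp h1)
  haveI : Finite A := Finite.of_injective _ hinj
  exact not_finite A

/-- **[AbsTopI] Lemma 4.5 (v), first sentence, at an open subgroup `H` — abstract form.**  Let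
`(I_c)_c` be a family of INFINITE subgroups of `G` that is MALNORMAL (`I_c ∩ x I_{c'} x⁻¹ = 1` unless
`c = c'` and `x ∈ I_c`) and `H ≤ G` of finite index.  Then the cuspidal subgroup `H ∩ x I_c x⁻¹` of
`H` at the cusp `H x I_c` is `H`-conjugate (by `h ∈ H`) to `H ∩ y I_{c'} y⁻¹` if and only if `c = c'`
and `y ∈ H x I_c` — i.e. «cusp of the `H`-covering ↦ `H`-conjugacy class of its cuspidal subgroup» is
well defined and injective on the double cosets `H \ G / I_c`; it is onto the cuspidal subgroups of
`H` by definition. [cite: MochizukiAbsTopI2012, Lemma 4.5 (v) p.55] [cite: MochizukiCombGC2007, Prop 1.2(i) p.8] -/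
theorem conj_inf_conj_eq_iff_of_malnormal (I : κ → Subgroup G) (hinf : ∀ c, Infinite (I c))
    (hmal : ∀ (c c' : κ) (x : G), (c ≠ c' ∨ x ∉ I c) → I c ⊓ ConjAct.toConjAct x • I c' = ⊥)
    (H : Subgroup G) [H.FiniteIndex] (c c' : κ) (x y : G) :
    (∃ h ∈ H, ConjAct.toConjAct h • (H ⊓ ConjAct.toConjAct x • I c) =
        H ⊓ ConjAct.toConjAct y • I c') ↔
      c = c' ∧ ∃ h ∈ H, ∃ k ∈ I c, y = h * x * k := by
  constructor
  · rintro ⟨h, hh, heq⟩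
    rw [Subgroup.smul_inf, toConjAct_smul_eq_self_of_mem hh, ← toConjAct_mul_smul] at heq
    -- `H ∩ (hx) I_c (hx)⁻¹ ≠ 1`
    haveI : Infinite ↥(ConjAct.toConjAct (h * x) • I c) :=
      haveI := hinf c
      Infinite.of_injective _ (Subgroup.equivSMul (ConjAct.toConjAct (h * x)) (I c)).injective
    have hne : H ⊓ ConjAct.toConjAct (h * x) • I c ≠ ⊥ := inf_ne_bot_of_finiteIndex_of_infinite _ _
    -- conjugate back by `(hx)⁻¹`: a non-trivial subgroup of `I_c ∩ ((hx)⁻¹ y) I_{c'} ((hx)⁻¹ y)⁻¹`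
    have hle : (ConjAct.toConjAct (h * x))⁻¹ • (H ⊓ ConjAct.toConjAct (h * x) • I c) ≤
        I c ⊓ ConjAct.toConjAct ((h * x)⁻¹ * y) • I c' := by
      refine le_inf ?_ ?_
      · rw [Subgroup.smul_inf, inv_smul_smul]
        exact inf_le_right
      · rw [heq, Subgroup.smul_inf, ← map_inv, ← toConjAct_mul_smul]
        exact inf_le_right
    have hne' : I c ⊓ ConjAct.toConjAct ((h * x)⁻¹ * y) • I c' ≠ ⊥ := by
      intro hbot
      rw [hbot, le_bot_iff, inv_smul_eq_iff, Subgroup.smul_bot] at hle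
      exact hne hle
    have hnot : ¬ (c ≠ c' ∨ (h * x)⁻¹ * y ∉ I c) := fun hor => hne' (hmal c c' _ hor)
    rw [not_or, not_ne_iff, not_not] at hnot
    exact ⟨hnot.1, h, hh, (h * x)⁻¹ * y, hnot.2, by group⟩
  · rintro ⟨rfl, h, hh, k, hk, rfl⟩
    refine ⟨h, hh, ?_⟩
    rw [Subgroup.smul_inf, toConjAct_smul_eq_self_of_mem hh, ← toConjAct_mul_smul,
      toConjAct_mul_smul (h * x) k, toConjAct_smul_eq_self_of_mem hk]

/-- **Sentence 1 at `H`, double-coset form**: for an infinite malnormal family and `H` of finite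
index, the cuspidal subgroups of `H` at the cusps `H x I_c`, `H y I_c` over the SAME cusp `c` are
`H`-conjugate iff the two cusps of the `H`-covering coincide (`H x I_c = H y I_c` in `H \ G / I_c`),
and cuspidal subgroups over DIFFERENT cusps `c ≠ c'` are never `H`-conjugate.
[cite: MochizukiAbsTopI2012, Lemma 4.5 (v) p.55] [cite: MochizukiCombGC2007, Def 1.1(ii) p.6] -/
theorem conj_inf_conj_eq_iff_doubleCoset_of_malnormal (I : κ → Subgroup G) (hinf : ∀ c, Infinite (I c))
    (hmal : ∀ (c c' : κ) (x : G), (c ≠ c' ∨ x ∉ I c) → I c ⊓ ConjAct.toConjAct x • I c' = ⊥)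
    (H : Subgroup G) [H.FiniteIndex] (c c' : κ) (x y : G) :
    ((∃ h ∈ H, ConjAct.toConjAct h • (H ⊓ ConjAct.toConjAct x • I c) =
        H ⊓ ConjAct.toConjAct y • I c) ↔
      DoubleCoset.mk H (I c) x = DoubleCoset.mk H (I c) y) ∧
    (c ≠ c' → ∀ h ∈ H, ConjAct.toConjAct h • (H ⊓ ConjAct.toConjAct x • I c) ≠
        H ⊓ ConjAct.toConjAct y • I c') := by
  refine ⟨?_, fun hcc h hh heq => hcc ?_⟩
  · rw [conj_inf_conj_eq_iff_of_malnormal I hinf hmal, DoubleCoset.eq]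
    exact ⟨fun h => h.2, fun h => ⟨rfl, h⟩⟩
  · exact ((conj_inf_conj_eq_iff_of_malnormal I hinf hmal H c c' x y).mp ⟨h, hh, heq⟩).1

omit [Group G] in
/-- **The cusps of a finite covering are finite in number**: for `H` of finite index the double-coset
space `H \ G / K` is finite (a quotient of `G / H` via `x H ↦ H x⁻¹ K`).
[cite: MochizukiCombGC2007, Def 1.1(ii) p.6] -/
theorem finite_doubleCosetQuotient_of_finiteIndex [Group G] (H K : Subgroup G) [H.FiniteIndex] :
    Finite (DoubleCoset.Quotient (H : Set G) (K : Set G)) := by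
  classical
  let f : G ⧸ H → DoubleCoset.Quotient (H : Set G) (K : Set G) := fun q =>
    Quotient.liftOn' q (fun x => DoubleCoset.mk H K x⁻¹) fun a b hab => by
      rw [QuotientGroup.leftRel_apply] at hab
      rw [DoubleCoset.eq]
      exact ⟨(a⁻¹ * b)⁻¹, H.inv_mem hab, 1, K.one_mem, by group⟩
  refine Finite.of_surjective f fun q => ?_
  induction q using Quotient.inductionOn with
  | h z => exact ⟨((z⁻¹ : G) : G ⧸ H), by simp [f]⟩

/-- **[AbsTopI] Lemma 4.5 (v), second sentence — functoriality in `H`** (abstract form): for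
`H′ ≤ H` the cuspidal subgroup of `H′` at the cusp `H′ x I_c` is the trace `H′ ∩ (H ∩ x I_c x⁻¹)` of
the cuspidal subgroup of `H` at the image cusp `H x I_c`, of finite index in it when `H′` has finite
index, and the map of cusps `H′ x I_c ↦ H x I_c` is well defined on the double cosets.
[cite: MochizukiAbsTopI2012, Lemma 4.5 (v) p.55] -/
theorem cuspidalIn_functorial {H' H : Subgroup G} (hle : H' ≤ H) (K : Subgroup G) (x : G) :
    H' ⊓ ConjAct.toConjAct x • K = H' ⊓ (H ⊓ ConjAct.toConjAct x • K) ∧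
    (H'.FiniteIndex →
      ((H' ⊓ ConjAct.toConjAct x • K).subgroupOf (H ⊓ ConjAct.toConjAct x • K)).FiniteIndex) ∧
    ∀ y : G, DoubleCoset.mk H' K x = DoubleCoset.mk H' K y →
      DoubleCoset.mk H K x = DoubleCoset.mk H K y := by
  have h1 : H' ⊓ ConjAct.toConjAct x • K = H' ⊓ (H ⊓ ConjAct.toConjAct x • K) := by
    rw [← inf_assoc, inf_of_le_left hle]
  refine ⟨h1, fun hfi => ?_, fun y hxy => ?_⟩
  · rw [h1, Subgroup.inf_subgroupOf_right]
    infer_instance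
  · rw [DoubleCoset.eq] at hxy ⊢
    obtain ⟨h, hh, k, hk, rfl⟩ := hxy
    exact ⟨h, hle hh, k, hk, rfl⟩

/-- **[AbsTopI] Lemma 4.5 (v), second sentence — compatibility with the `Π`-actions** (abstract
form): conjugation by `γ` carries the cuspidal subgroup of `H` at the cusp `H x I_c` to the cuspidal
subgroup of `γ H γ⁻¹` at the cusp `(γHγ⁻¹)(γx) I_c`, and the map of cusps `H x I_c ↦ (γHγ⁻¹)(γ x) I_c`
is a well-defined bijection of double-coset spaces. [cite: MochizukiAbsTopI2012, Lemma 4.5 (v) p.55] -/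
theorem cuspidalIn_conj_equivariant (H K : Subgroup G) (γ x : G) :
    ConjAct.toConjAct γ • (H ⊓ ConjAct.toConjAct x • K) =
      ConjAct.toConjAct γ • H ⊓ ConjAct.toConjAct (γ * x) • K ∧
    ∀ y : G, DoubleCoset.mk H K x = DoubleCoset.mk H K y ↔
      DoubleCoset.mk (ConjAct.toConjAct γ • H) K (γ * x) =
        DoubleCoset.mk (ConjAct.toConjAct γ • H) K (γ * y) := by
  have key : ∀ (L : Subgroup G) (δ a b : G), DoubleCoset.mk L K a = DoubleCoset.mk L K b →
      DoubleCoset.mk (ConjAct.toConjAct δ • L) K (δ * a) =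
        DoubleCoset.mk (ConjAct.toConjAct δ • L) K (δ * b) := by
    intro L δ a b hab
    rw [DoubleCoset.eq] at hab ⊢
    obtain ⟨h, hh, k, hk, rfl⟩ := hab
    refine ⟨δ * h * δ⁻¹, ?_, k, hk, by group⟩
    rw [Subgroup.mem_smul_pointwise_iff_exists]
    exact ⟨h, hh, ConjAct.toConjAct_smul δ h⟩
  refine ⟨by rw [Subgroup.smul_inf, ← toConjAct_mul_smul], fun y => ⟨key H γ x y, fun h => ?_⟩⟩
  have := key (ConjAct.toConjAct γ • H) γ⁻¹ (γ * x) (γ * y) h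
  rwa [map_inv, inv_smul_smul, inv_mul_cancel_left, inv_mul_cancel_left] at this

end Abstract

/-! ## §2. The genuine carrier: open subgroups of a pro-`Σ` surface group -/

section Genuine

variable {Sigma : Set ℕ} {g r : ℕ} {P : Type u} [Group P] [TopologicalSpace P] [IsTopologicalGroup P]
  [CompactSpace P] [T2Space P] [TotallyDisconnectedSpace P]

omit [T2Space P] [TotallyDisconnectedSpace P] in
/-- An open subgroup of a compact group has finite index. [folklore] -/
private theorem finiteIndex_of_isOpen' (H : Subgroup P) (hH : IsOpen (H : Set P)) : H.FiniteIndex := by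
  haveI : DiscreteTopology (P ⧸ H) := QuotientGroup.discreteTopology hH
  haveI : Finite (P ⧸ H) := finite_of_compact_of_discrete
  exact Subgroup.finiteIndex_of_finite_quotient

/-- **[AbsTopI] Lemma 4.5 (v), sentences 1–2, at EVERY open subgroup of a pro-`Σ` surface group.**
For a pro-`Σ` completion `ι : Γ_{g,r} → Π` (`Σ` nonempty set of primes, `(g,r)` hyperbolic, `Π`
profinite) with closed cusp inertia groups `Ī_c = closure ι⟨c_c⟩`, an OPEN subgroup `H ≤ Π`, cusps
`c, c'` and `x, y ∈ Π`: the cuspidal subgroup `H ∩ x Ī_c x⁻¹` of `H` (= the decomposition group, in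
the geometric group `H`, of the cusp `H x Ī_c` of the covering `X_H → X`) is `H`-conjugate to
`H ∩ y Ī_{c'} y⁻¹` iff `c = c'` and `H x Ī_c = H y Ī_c` — so «cusps of `X_H`» = `⨆_c H \ Π / Ī_c` ↔
«`H`-conjugacy classes of cuspidal subgroups of `H`» is a bijection (malnormality of cusp inertia,
`proSigmaCuspInertiaMalnormal_holds`).  Functoriality in `H` and `Π`-equivariance are
`cuspidalIn_functorial` / `cuspidalIn_conj_equivariant`.
[cite: MochizukiAbsTopI2012, Lemma 4.5 (v) p.55] [cite: MochizukiSemiAnbd2006, Ex. 2.10 p.31] -/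
theorem conj_inf_cuspInertia_eq_iff (hne : Sigma.Nonempty) (hprime : ∀ p ∈ Sigma, p.Prime)
    (hgr : PuncturedSurfaceGroup.IsHyperbolicType g r) (ι : PuncturedSurfaceGroup g r →* P)
    (hι : IsProSigmaCompletion Sigma ι) (H : Subgroup P) (hH : IsOpen (H : Set P))
    (c c' : Fin r) (x y : P) :
    (∃ h ∈ H, ConjAct.toConjAct h •
        (H ⊓ ConjAct.toConjAct x •
          ((PuncturedSurfaceGroup.cuspInertia (g := g) c).map ι).topologicalClosure) =
        H ⊓ ConjAct.toConjAct y •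
          ((PuncturedSurfaceGroup.cuspInertia (g := g) c').map ι).topologicalClosure) ↔
      c = c' ∧ ∃ h ∈ H,
        ∃ k ∈ ((PuncturedSurfaceGroup.cuspInertia (g := g) c).map ι).topologicalClosure,
          y = h * x * k := by
  haveI := finiteIndex_of_isOpen' H hH
  have hfact := fun i j => proSigmaCuspInertiaMalnormal_holds Sigma hne hprime g r hgr P ι hι i j
  exact conj_inf_conj_eq_iff_of_malnormal
    (fun i => ((PuncturedSurfaceGroup.cuspInertia (g := g) i).map ι).topologicalClosure)
    (fun i => (hfact i i).1) (fun i j z hz => (hfact i j).2 z hz) H c c' x y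

/-- **Double-coset form at the genuine carrier**: over the same cusp `c`, `H ∩ x Ī_c x⁻¹` and
`H ∩ y Ī_c y⁻¹` are `H`-conjugate iff `H x Ī_c = H y Ī_c` in `H \ Π / Ī_c` (the cusps of `X_H` over
`c`, the summand of `PSCDatum.cuspCount H`); over different cusps they are never `H`-conjugate; and
`H \ Π / Ī_c` is finite. [cite: MochizukiAbsTopI2012, Lemma 4.5 (v) p.55] [cite: MochizukiCombGC2007, Def 1.1(ii) p.6] -/
theorem conj_inf_cuspInertia_eq_iff_doubleCoset (hne : Sigma.Nonempty)
    (hprime : ∀ p ∈ Sigma, p.Prime) (hgr : PuncturedSurfaceGroup.IsHyperbolicType g r)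
    (ι : PuncturedSurfaceGroup g r →* P) (hι : IsProSigmaCompletion Sigma ι) (H : Subgroup P)
    (hH : IsOpen (H : Set P)) (c c' : Fin r) (x y : P) :
    ((∃ h ∈ H, ConjAct.toConjAct h •
        (H ⊓ ConjAct.toConjAct x •
          ((PuncturedSurfaceGroup.cuspInertia (g := g) c).map ι).topologicalClosure) =
        H ⊓ ConjAct.toConjAct y •
          ((PuncturedSurfaceGroup.cuspInertia (g := g) c).map ι).topologicalClosure) ↔
      DoubleCoset.mk H (((PuncturedSurfaceGroup.cuspInertia (g := g) c).map ι).topologicalClosure) x =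
        DoubleCoset.mk H (((PuncturedSurfaceGroup.cuspInertia (g := g) c).map ι).topologicalClosure)
          y) ∧
    (c ≠ c' → ∀ h ∈ H, ConjAct.toConjAct h •
        (H ⊓ ConjAct.toConjAct x •
          ((PuncturedSurfaceGroup.cuspInertia (g := g) c).map ι).topologicalClosure) ≠
        H ⊓ ConjAct.toConjAct y •
          ((PuncturedSurfaceGroup.cuspInertia (g := g) c').map ι).topologicalClosure) ∧
    Finite (DoubleCoset.Quotient (H : Set P)
      (((PuncturedSurfaceGroup.cuspInertia (g := g) c).map ι).topologicalClosure : Set P)) := by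
  haveI := finiteIndex_of_isOpen' H hH
  have hfact := fun i j => proSigmaCuspInertiaMalnormal_holds Sigma hne hprime g r hgr P ι hι i j
  obtain ⟨h1, h2⟩ := conj_inf_conj_eq_iff_doubleCoset_of_malnormal
    (fun i => ((PuncturedSurfaceGroup.cuspInertia (g := g) i).map ι).topologicalClosure)
    (fun i => (hfact i i).1) (fun i j z hz => (hfact i j).2 z hz) H c c' x y
  exact ⟨h1, h2, finite_doubleCosetQuotient_of_finiteIndex _ _⟩

end Genuine

end Literature.AnabelianGeometry.SemiGraphs.SemiGraphOfAnabelioids.IsProSigmaCompletion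

/-! ## §3. PSC vocabulary: smooth-curve data -/

namespace Literature.AnabelianGeometry.SemiGraphs.PSCDatum

open Literature.GroupTheory.CombinatorialGroupTheory
open Literature.AnabelianGeometry.SemiGraphs.SemiGraphOfAnabelioids

universe u

variable {P : Type u} [Group P] [TopologicalSpace P]

/-- The cuspidal subgroups of `Π_{G_H} = H` ([CombGC] Def. 1.1 (ii): `PSCDatum.IsCuspidalIn`) are
exactly the `H ∩ x Π_c x⁻¹`, `c` a cusp of `G`, `x ∈ Π_G` — the map «cusp `(c, H x Π_c)` of `G_H` ↦
cuspidal subgroup» is ONTO by definition. [cite: MochizukiCombGC2007, Def 1.1(ii) p.7] -/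
theorem isCuspidalIn_iff_exists (G : PSCDatum P) (H A : Subgroup P) :
    G.IsCuspidalIn H A ↔ ∃ (c : G.graph.C) (x : P), A = H ⊓ ConjAct.toConjAct x • G.cuspGp c := by
  constructor
  · rintro ⟨B, ⟨c, γ, rfl⟩, rfl⟩
    exact ⟨c, ConjAct.ofConjAct γ, by rw [ConjAct.toConjAct_ofConjAct]⟩
  · rintro ⟨c, x, rfl⟩
    exact ⟨_, ⟨c, ConjAct.toConjAct x, rfl⟩, rfl⟩

variable [IsTopologicalGroup P] [CompactSpace P] [T2Space P] [TotallyDisconnectedSpace P]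
  {Sigma : Set ℕ} {g r : ℕ}

/-- **[AbsTopI] Lemma 4.5 (v), sentences 1–2, at every open subgroup of a SMOOTH-CURVE pro-`Σ` PSC
group** (`G : PSCDatum Π` whose cusp groups are the closed cusp inertia groups of a pro-`Σ` completion
`ι : Γ_{g,r} → Π`): for `H ≤ Π` open, cusps `c, c'` of `G` and `x, y ∈ Π`, the cuspidal subgroups
`H ∩ x Π_c x⁻¹`, `H ∩ y Π_{c'} y⁻¹` of `H` are `H`-conjugate iff `c = c'` and `H x Π_c = H y Π_c` —
the cusps of `G_H` (`⨆_c H \ Π / Π_c`, counted by `G.cuspCount H`) ↔ `H`-conjugacy classes of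
cuspidal subgroups of `H` (`G.IsCuspidalIn H`, onto by `isCuspidalIn_iff_exists`); functorial in `H`
and `Π`-equivariant by `IsProSigmaCompletion.cuspidalIn_functorial` /
`IsProSigmaCompletion.cuspidalIn_conj_equivariant`.  (abc-iut-f-060 gen 5's
`CuspInertiaData.cuspsBijInertiaClasses_ofPSC_of_smoothCurve` is the case `H = Π`.)
[cite: MochizukiAbsTopI2012, Lemma 4.5 (v) p.55] [cite: MochizukiCombGC2007, Prop 1.2(i) p.8] -/
theorem conj_inf_cuspGp_eq_iff_of_smoothCurve (hne : Sigma.Nonempty) (hprime : ∀ p ∈ Sigma, p.Prime)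
    (hgr : PuncturedSurfaceGroup.IsHyperbolicType g r) (ι : PuncturedSurfaceGroup g r →* P)
    (hι : IsProSigmaCompletion Sigma ι) (G : PSCDatum P) (e : G.graph.C ≃ Fin r)
    (hC : ∀ c, G.cuspGp c =
      ((PuncturedSurfaceGroup.cuspInertia (g := g) (e c)).map ι).topologicalClosure)
    (H : Subgroup P) (hH : IsOpen (H : Set P)) (c c' : G.graph.C) (x y : P) :
    ((∃ h ∈ H, ConjAct.toConjAct h • (H ⊓ ConjAct.toConjAct x • G.cuspGp c) =
        H ⊓ ConjAct.toConjAct y • G.cuspGp c') ↔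
      c = c' ∧ DoubleCoset.mk H (G.cuspGp c) x = DoubleCoset.mk H (G.cuspGp c) y) ∧
    Finite (DoubleCoset.Quotient (H : Set P) (G.cuspGp c : Set P)) := by
  have key := IsProSigmaCompletion.conj_inf_cuspInertia_eq_iff hne hprime hgr ι hι H hH (e c) (e c') x y
  rw [← hC, ← hC, e.apply_eq_iff_eq] at key
  refine ⟨?_, ?_⟩
  · rw [key, DoubleCoset.eq]
  · rw [hC]
    exact (IsProSigmaCompletion.conj_inf_cuspInertia_eq_iff_doubleCoset hne hprime hgr ι hι H hH
      (e c) (e c) x y).2.2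

end Literature.AnabelianGeometry.SemiGraphs.PSCDatum

end
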